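import Summits.Ventures.PercRepro.C025ProfileGenHall
import Summits.Ventures.PercRepro.C025ProfileGenCor

/-!
# Corollaries of the Hall row (2,3) in the shadow vocabulary (night-3 g8)

`hallIneq_two_three` restricted to a family of bottom sets of `(p, 2)` (night-2's `ShadowC025Level` at the level `u = 3`,
every `p ≥ 3`): for every `𝒜 ⊆ PerFlat.Uq M p 2`, `#𝒜 · C(p+2,3)/C(p+2,2) ≤ #shadowLevel M 3 𝒜`, i.e.
`p · #𝒜 ≤ 3 · #{S : ρ(S) = 3, ∃ B ∈ 𝒜, B ⊆ S}` — the level-`3` input of the per-flat / shadow Hall forms at `q = 2`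
in every rank.
-/

open scoped Matroid

namespace PercRepro

open Set Finset ThmH

section GenCor2

variable {α : Type} [DecidableEq α]

/-- **The shadow form at `(q, u) = (2, 3)` for every `p ≥ 3` and every family of bottom sets.** -/
theorem shadow_two_three_of_Uq (M : Matroid α) [M.Finite] {p : ℕ} (hp : 3 ≤ p) {𝒜 : Finset (Finset α)}
    (h𝒜 : 𝒜 ⊆ PerFlat.Uq M p 2) :
    (𝒜.card : ℚ) * ((Nat.choose (p + 2) 3 : ℚ) / (Nat.choose (p + 2) 2 : ℚ)) ≤
      ((Shadow.shadowLevel M 3 𝒜).card : ℚ) := by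
  have hsub : 𝒜 ⊆ Profile.Rq M 2 := h𝒜.trans (Profile.Uq_subset_Rq p 2)
  have h1 := hallIneq_two_three M 𝒜 hsub
  have h2 : ∑ B ∈ 𝒜, Profile.price M 2 3 B =
      (𝒜.card : ℚ) * ((Nat.choose (p + 2) 3 : ℚ) / (Nat.choose (p + 2) 2 : ℚ)) := by
    rw [Finset.sum_congr rfl (fun B hB => Profile.price_of_mem_Uq hp (h𝒜 hB)), Finset.sum_const, nsmul_eq_mul]
  rw [← h2]
  exact h1

/-- The same in integers: `p · #𝒜 ≤ 3 · #shadowLevel M 3 𝒜`. -/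
theorem mul_card_le_three_mul_card_shadowLevel_three (M : Matroid α) [M.Finite] {p : ℕ} (hp : 3 ≤ p)
    {𝒜 : Finset (Finset α)} (h𝒜 : 𝒜 ⊆ PerFlat.Uq M p 2) :
    p * 𝒜.card ≤ 3 * (Shadow.shadowLevel M 3 𝒜).card := by
  have h := shadow_two_three_of_Uq M hp h𝒜
  rw [choose_ratio_two_three] at h
  have h' : (p : ℚ) * (𝒜.card : ℚ) ≤ 3 * ((Shadow.shadowLevel M 3 𝒜).card : ℚ) := by
    have : (𝒜.card : ℚ) * ((p : ℚ) / 3) ≤ ((Shadow.shadowLevel M 3 𝒜).card : ℚ) := h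
    rw [mul_div_assoc', div_le_iff₀ (by norm_num)] at this
    linarith
  exact_mod_cast h'

end GenCor2

end PercRepro
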